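import Mathlib
import Summits.AtomisticToContinuum.FouriersLaw.Theorems.EmbeddedDrudeMourreMourreDissolutionRegularLevels
import Summits.AtomisticToContinuum.FouriersLaw.Theorems.EmbeddedDrudeMourreMourreDissolutionPairThresholdB
import HarnessLib

/-!
# Continuity of the weighted two-phonon density of states near the threshold, auxiliary facts —
# helpers for `stub_continuousDensityAssembly` (stub ASM) of line `swap-odd-threshold-rigidity`
(crux `EmbeddedDrudeMourre.MourreDissolution`, item stmt-AtomisticToContinuum-12594; helper file, `--supports`)

Closed helper lemmas (prefix `contAsm_`) for the registered stub ASM of the checked skeleton of line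
`swap-odd-threshold-rigidity` (lead c9), in the skeleton's stub namespace
`Summit.AtomisticToContinuum.FouriersLaw.Theorems.MourreDissolution`; headline `contAsm_crit`.

* `contAsm_exists_cut`, `contAsm_exists_cutoff`: the continuous `[0,1]`-valued slab cutoff
  `θ(p) = Θ(sin((k₃−k₁)/2))·Θ(sin((k₂−k₃)/2))`, `Θ(s) = min 1 (max 0 (2|s|/η − 1))`, at
  `p = (k₁,(k₃,k₂))`: coordinatewise `2π`-periodic, `θ ≠ 0 ⇒` both half-angle sines `≥ η/2`,
  both `≥ η ⇒ θ = 1`.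
* `contAsm_psi_*`: the hat weight `ψ(p) = Λ(k₁)Λ(k₃)Λ(k₂)`, `Λ(t) = max 0 (1 − |t|/2π)`, of the
  periodisation identity is continuous, `≥ 0`, compactly supported (in `[−2π,2π]³`).
* `contAsm_contDiff_resonanceFn`, `contAsm_hasFDerivAt_resonanceFn`,
  `contAsm_velocity_eq_of_fderiv_eq_zero`: `Ω(k₁,k₂,k₃) = ω₁ + ω₂ − ω₃ − ω(k₁+k₂−k₃)` read at
  `p = (k₁,(k₃,k₂))` is `C¹` (the gapped band `ω = dispersion ω₂` is analytic) with derivative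
  `v₁dk₁ + v₂dk₂ − v₃dk₃ − v₄(dk₁+dk₂−dk₃)` (`v = groupVelocity ω₂ = ω'`), so a critical point has
  `v₁ = v₂ = v₃ = v₄`.
* `contAsm_crit` (THE REGULAR-VALUE CHECK): at a critical point with `|Ω| ≤ √(ω₂+4) − √ω₂` one of
  `sin((k₃−k₁)/2)`, `sin((k₂−k₃)/2)` vanishes — by RL (`stub_regularLevels`, landed) the critical
  value is `0` (the corner value `2(√(ω₂+4) − √ω₂)` is excluded) and by A (`stub_pairThreshold`,
  landed) level-`0` critical points are exchange-diagonal, `k₃ ≡ k₁` or `k₃ ≡ k₂ (mod 2π)`.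
* `contAsm_resonanceFn_periodic`, `contAsm_vertex_periodic`: coordinatewise `2π`-periodicity.
* `contAsm_cell_measure`, `contAsm_map_withDensity_apply`: the cell measure `dk₁(dk₃dk₂)` on
  `(−π,π]³` is Lebesgue measure restricted to the cube, and `(Ω_*(Gμ))(A) = ∫ 1_A(Ω)·G dμ`.
Elementary real analysis and measure plumbing; no cited facts.
-/

noncomputable section

namespace Summit.AtomisticToContinuum.FouriersLaw.Theorems.MourreDissolution

open MeasureTheory Filter Set Function Topology
open scoped ENNReal NNReal Topology
open Literature.MathematicalPhysics.KineticTheory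
open Literature.MathematicalPhysics.KineticTheory.PhononBoltzmann


/-! ### The cutoff -/

/-- A continuous even cutoff `Θ : ℝ → [0, 1]` with `Θ = 0` on `[-η/2, η/2]` and `Θ = 1` off
`(-η, η)` (`Θ(s) = min 1 (max 0 (2|s|/η − 1))`). [folklore] -/
theorem contAsm_exists_cut {η : ℝ} (hη : 0 < η) :
    ∃ Θ : ℝ → ℝ, Continuous Θ ∧ (∀ s, 0 ≤ Θ s) ∧ (∀ s, Θ s ≤ 1) ∧ (∀ s, Θ (-s) = Θ s) ∧
      (∀ s, Θ s ≠ 0 → η / 2 ≤ |s|) ∧ (∀ s, η ≤ |s| → Θ s = 1) := by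
  refine ⟨fun s => min 1 (max 0 (2 * |s| / η - 1)), ?_, fun s => le_min zero_le_one (le_max_left _ _),
    fun s => min_le_left _ _, fun s => by simp only [abs_neg], fun s hs => ?_, fun s hs => ?_⟩
  · fun_prop
  · by_contra h
    push Not at h
    have hle : 2 * |s| / η - 1 ≤ 0 := by
      rw [sub_nonpos, div_le_one hη]
      linarith
    exact hs (by simp only [max_eq_left hle, min_eq_right (zero_le_one (α := ℝ))])
  · have h1 : (1 : ℝ) ≤ 2 * |s| / η - 1 := by
      rw [le_sub_iff_add_le, le_div_iff₀ hη]
      linarith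
    exact min_eq_left (h1.trans (le_max_right _ _))

/-- The slab cutoff `θ(p) = Θ(sin((k₃−k₁)/2))·Θ(sin((k₂−k₃)/2))` at `p = (k₁,(k₃,k₂))`: continuous,
`[0,1]`-valued, coordinatewise `2π`-periodic, supported where both half-angle sines are `≥ η/2` in
modulus, and `= 1` where both are `≥ η`. [folklore] -/
theorem contAsm_exists_cutoff {η : ℝ} (hη : 0 < η) :
    ∃ θ : ℝ × ℝ × ℝ → ℝ, Continuous θ ∧ (∀ p, 0 ≤ θ p) ∧ (∀ p, θ p ≤ 1) ∧
      (∀ p : ℝ × ℝ × ℝ, θ (p.1 + 2 * Real.pi, p.2) = θ p) ∧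
      (∀ p : ℝ × ℝ × ℝ, θ (p.1, p.2.1 + 2 * Real.pi, p.2.2) = θ p) ∧
      (∀ p : ℝ × ℝ × ℝ, θ (p.1, p.2.1, p.2.2 + 2 * Real.pi) = θ p) ∧
      (∀ p : ℝ × ℝ × ℝ, θ p ≠ 0 →
        η / 2 ≤ |Real.sin ((p.2.1 - p.1) / 2)| ∧ η / 2 ≤ |Real.sin ((p.2.2 - p.2.1) / 2)|) ∧
      (∀ p : ℝ × ℝ × ℝ, η ≤ |Real.sin ((p.2.1 - p.1) / 2)| → η ≤ |Real.sin ((p.2.2 - p.2.1) / 2)| →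
        θ p = 1) := by
  obtain ⟨Θ, hΘc, hΘ0, hΘ1, hΘneg, hΘne, hΘone⟩ := contAsm_exists_cut hη
  refine ⟨fun p => Θ (Real.sin ((p.2.1 - p.1) / 2)) * Θ (Real.sin ((p.2.2 - p.2.1) / 2)), by fun_prop,
    fun p => mul_nonneg (hΘ0 _) (hΘ0 _), fun p => mul_le_one₀ (hΘ1 _) (hΘ0 _) (hΘ1 _),
    fun p => ?_, fun p => ?_, fun p => ?_, fun p hp => ?_, fun p h1 h2 => ?_⟩
  · dsimp only
    rw [show (p.2.1 - (p.1 + 2 * Real.pi)) / 2 = (p.2.1 - p.1) / 2 - Real.pi by ring,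
      Real.sin_sub_pi, hΘneg]
  · dsimp only
    rw [show (p.2.1 + 2 * Real.pi - p.1) / 2 = (p.2.1 - p.1) / 2 + Real.pi by ring,
      show (p.2.2 - (p.2.1 + 2 * Real.pi)) / 2 = (p.2.2 - p.2.1) / 2 - Real.pi by ring,
      Real.sin_add_pi, Real.sin_sub_pi, hΘneg, hΘneg]
  · dsimp only
    rw [show (p.2.2 + 2 * Real.pi - p.2.1) / 2 = (p.2.2 - p.2.1) / 2 + Real.pi by ring,
      Real.sin_add_pi, hΘneg]
  · exact ⟨hΘne _ (left_ne_zero_of_mul hp), hΘne _ (right_ne_zero_of_mul hp)⟩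
  · dsimp only
    rw [hΘone _ h1, hΘone _ h2, one_mul]

/-! ### The hat weight of the periodisation -/

/-- The hat weight `ψ(p) = Λ(k₁)Λ(k₃)Λ(k₂)`, `Λ(t) = max 0 (1 − |t|/2π)`, is continuous. [folklore] -/
theorem contAsm_psi_continuous :
    Continuous fun p : ℝ × ℝ × ℝ => max 0 (1 - |p.1| / (2 * Real.pi)) *
      (max 0 (1 - |p.2.1| / (2 * Real.pi)) * max 0 (1 - |p.2.2| / (2 * Real.pi))) := by
  fun_prop

/-- The hat weight is non-negative. [folklore] -/
theorem contAsm_psi_nonneg (p : ℝ × ℝ × ℝ) :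
    0 ≤ max 0 (1 - |p.1| / (2 * Real.pi)) *
      (max 0 (1 - |p.2.1| / (2 * Real.pi)) * max 0 (1 - |p.2.2| / (2 * Real.pi))) :=
  mul_nonneg (le_max_left _ _) (mul_nonneg (le_max_left _ _) (le_max_left _ _))

/-- The hat weight is supported in the compact box `[-2π, 2π]³`. [folklore] -/
theorem contAsm_psi_hasCompactSupport :
    HasCompactSupport fun p : ℝ × ℝ × ℝ => max 0 (1 - |p.1| / (2 * Real.pi)) *
      (max 0 (1 - |p.2.1| / (2 * Real.pi)) * max 0 (1 - |p.2.2| / (2 * Real.pi))) := by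
  have hat0 : ∀ t : ℝ, t ∉ Icc (-(2 * Real.pi)) (2 * Real.pi) →
      max 0 (1 - |t| / (2 * Real.pi)) = 0 := fun t ht => by
    apply max_eq_left
    rw [sub_nonpos, le_div_iff₀ Real.two_pi_pos, one_mul]
    simp only [mem_Icc, not_and_or, not_le] at ht
    rcases ht with h | h
    · rw [abs_of_neg (by linarith [Real.pi_pos])]; linarith
    · rw [abs_of_pos (by linarith [Real.pi_pos])]; linarith
  refine HasCompactSupport.intro (K := Icc (-(2 * Real.pi)) (2 * Real.pi) ×ˢ
      (Icc (-(2 * Real.pi)) (2 * Real.pi) ×ˢ Icc (-(2 * Real.pi)) (2 * Real.pi)))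
    (isCompact_Icc.prod (isCompact_Icc.prod isCompact_Icc)) fun p hp => ?_
  simp only [mem_prod, not_and_or] at hp
  rcases hp with h | h | h
  · rw [hat0 _ h, zero_mul]
  · rw [hat0 _ h, zero_mul, mul_zero]
  · rw [hat0 _ h, mul_zero, mul_zero]

/-! ### The window and the regular-value check -/

/-- The window half-width `δ = √(ω₂+4) − √ω₂ = ω(π) − ω(0)` is positive. [folklore] -/
theorem contAsm_delta_pos {ω₂ : ℝ} (hω : 0 < ω₂) : 0 < Real.sqrt (ω₂ + 4) - Real.sqrt ω₂ :=
  sub_pos.2 (Real.sqrt_lt_sqrt hω.le (by linarith))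

/-- The resonance function read at `p = (k₁,(k₃,k₂))` is `C¹` (the gapped band is analytic).
[folklore] -/
theorem contAsm_contDiff_resonanceFn {ω₂ : ℝ} (hω : 0 < ω₂) :
    ContDiff ℝ 1 fun p : ℝ × ℝ × ℝ => resonanceFn ω₂ p.1 p.2.2 p.2.1 := by
  have hd : ContDiff ℝ 1 (dispersion ω₂) :=
    contDiff_iff_contDiffAt.2 fun k => (analyticAt_dispersion hω k).contDiffAt
  have c1 : ContDiff ℝ 1 fun p : ℝ × ℝ × ℝ => p.1 := contDiff_fst
  have c2 : ContDiff ℝ 1 fun p : ℝ × ℝ × ℝ => p.2.1 := contDiff_fst.comp contDiff_snd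
  have c3 : ContDiff ℝ 1 fun p : ℝ × ℝ × ℝ => p.2.2 := contDiff_snd.comp contDiff_snd
  unfold resonanceFn
  exact (((hd.comp c1).add (hd.comp c3)).sub (hd.comp c2)).sub (hd.comp ((c1.add c3).sub c2))

/-- The Fréchet derivative of `p = (k₁,(k₃,k₂)) ↦ Ω(k₁,k₂,k₃)`:
`v₁ dk₁ + v₂ dk₂ − v₃ dk₃ − v₄ (dk₁ + dk₂ − dk₃)`, `vⱼ = ω'(kⱼ)`, `k₄ = k₁ + k₂ − k₃`. [folklore] -/
theorem contAsm_hasFDerivAt_resonanceFn {ω₂ : ℝ} (hω : 0 < ω₂) (p : ℝ × ℝ × ℝ) :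
    HasFDerivAt (fun p : ℝ × ℝ × ℝ => resonanceFn ω₂ p.1 p.2.2 p.2.1)
      (groupVelocity ω₂ p.1 • ContinuousLinearMap.fst ℝ ℝ (ℝ × ℝ) +
        groupVelocity ω₂ p.2.2 •
          (ContinuousLinearMap.snd ℝ ℝ ℝ).comp (ContinuousLinearMap.snd ℝ ℝ (ℝ × ℝ)) -
        groupVelocity ω₂ p.2.1 •
          (ContinuousLinearMap.fst ℝ ℝ ℝ).comp (ContinuousLinearMap.snd ℝ ℝ (ℝ × ℝ)) -
        groupVelocity ω₂ (p.1 + p.2.2 - p.2.1) •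
          (ContinuousLinearMap.fst ℝ ℝ (ℝ × ℝ) +
            (ContinuousLinearMap.snd ℝ ℝ ℝ).comp (ContinuousLinearMap.snd ℝ ℝ (ℝ × ℝ)) -
            (ContinuousLinearMap.fst ℝ ℝ ℝ).comp (ContinuousLinearMap.snd ℝ ℝ (ℝ × ℝ)))) p := by
  have h1 : HasFDerivAt (fun p : ℝ × ℝ × ℝ => p.1) (ContinuousLinearMap.fst ℝ ℝ (ℝ × ℝ)) p :=
    hasFDerivAt_fst
  have h3 : HasFDerivAt (fun p : ℝ × ℝ × ℝ => p.2.2)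
      ((ContinuousLinearMap.snd ℝ ℝ ℝ).comp (ContinuousLinearMap.snd ℝ ℝ (ℝ × ℝ))) p :=
    hasFDerivAt_snd.comp p hasFDerivAt_snd
  have h2 : HasFDerivAt (fun p : ℝ × ℝ × ℝ => p.2.1)
      ((ContinuousLinearMap.fst ℝ ℝ ℝ).comp (ContinuousLinearMap.snd ℝ ℝ (ℝ × ℝ))) p :=
    hasFDerivAt_fst.comp p hasFDerivAt_snd
  have h4 := (h1.add h3).sub h2
  have d1 := (hasDerivAt_dispersion hω p.1).comp_hasFDerivAt p h1
  have d2 := (hasDerivAt_dispersion hω p.2.2).comp_hasFDerivAt p h3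
  have d3 := (hasDerivAt_dispersion hω p.2.1).comp_hasFDerivAt p h2
  have d4 := (hasDerivAt_dispersion hω (p.1 + p.2.2 - p.2.1)).comp_hasFDerivAt p h4
  unfold resonanceFn
  exact ((d1.add d2).sub d3).sub d4

/-- A critical point of `p = (k₁,(k₃,k₂)) ↦ Ω(k₁,k₂,k₃)` has four equal group velocities
`v(k₁) = v(k₂) = v(k₃) = v(k₁+k₂−k₃)`. [folklore] -/
theorem contAsm_velocity_eq_of_fderiv_eq_zero {ω₂ : ℝ} (hω : 0 < ω₂) {p : ℝ × ℝ × ℝ}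
    (h : fderiv ℝ (fun p : ℝ × ℝ × ℝ => resonanceFn ω₂ p.1 p.2.2 p.2.1) p = 0) :
    groupVelocity ω₂ p.1 = groupVelocity ω₂ p.2.2 ∧
      groupVelocity ω₂ p.2.2 = groupVelocity ω₂ p.2.1 ∧
      groupVelocity ω₂ p.2.1 = groupVelocity ω₂ (p.1 + p.2.2 - p.2.1) := by
  rw [(contAsm_hasFDerivAt_resonanceFn hω p).fderiv] at h
  have e1 := congrArg (fun L : ℝ × ℝ × ℝ →L[ℝ] ℝ => L (1, 0, 0)) h
  have e2 := congrArg (fun L : ℝ × ℝ × ℝ →L[ℝ] ℝ => L (0, 0, 1)) h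
  have e3 := congrArg (fun L : ℝ × ℝ × ℝ →L[ℝ] ℝ => L (0, 1, 0)) h
  simp only [add_apply, sub_apply, smul_apply, ContinuousLinearMap.comp_apply,
    ContinuousLinearMap.coe_fst', ContinuousLinearMap.coe_snd', smul_eq_mul, mul_one, mul_zero,
    add_zero, sub_zero, zero_add, zero_sub, zero_apply] at e1 e2 e3
  exact ⟨by linarith, by linarith, by linarith⟩

/-- **The regular-value check.** At a critical point `p = (k₁,(k₃,k₂))` of `Ω` with
`|Ω| ≤ √(ω₂+4) − √ω₂` one of the half-angle sines `sin((k₃−k₁)/2)`, `sin((k₂−k₃)/2)` vanishes: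
by RL (`stub_regularLevels`) the critical value is `0` (the corner value `2(√(ω₂+4) − √ω₂)` being
excluded), and by A (`stub_pairThreshold`) the level-`0` critical points are exchange-diagonal.
[folklore] -/
theorem contAsm_crit :
    ∀ ω₂ : ℝ, 0 < ω₂ → ∀ p : ℝ × ℝ × ℝ,
      |resonanceFn ω₂ p.1 p.2.2 p.2.1| ≤ Real.sqrt (ω₂ + 4) - Real.sqrt ω₂ →
      fderiv ℝ (fun p : ℝ × ℝ × ℝ => resonanceFn ω₂ p.1 p.2.2 p.2.1) p = 0 →
      Real.sin ((p.2.1 - p.1) / 2) = 0 ∨ Real.sin ((p.2.2 - p.2.1) / 2) = 0 := by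
  intro ω₂ hω p hΩ h
  obtain ⟨h12, h23, h34⟩ := contAsm_velocity_eq_of_fderiv_eq_zero hω h
  have hδ := contAsm_delta_pos hω
  have hzero : resonanceFn ω₂ p.1 p.2.2 p.2.1 = 0 := by
    rcases stub_regularLevels ω₂ hω p.1 p.2.2 p.2.1 h12 h23 h34 with h0 | h0
    · exact h0
    · rw [h0] at hΩ
      linarith
  rcases stub_pairThreshold ω₂ hω p.1 p.2.2 p.2.1 hzero h12 h23 h34 with ⟨n, hn⟩ | ⟨n, hn⟩
  · left
    rw [hn, show (p.1 + 2 * Real.pi * n - p.1) / 2 = n * Real.pi by ring, Real.sin_int_mul_pi]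
  · right
    rw [hn, show (p.2.2 - (p.2.2 + 2 * Real.pi * n)) / 2 = -(n * Real.pi) by ring, Real.sin_neg,
      Real.sin_int_mul_pi, neg_zero]

/-! ### Periodicity of the vocabulary -/

/-- The resonance function is `2π`-periodic in each momentum. [folklore] -/
theorem contAsm_resonanceFn_periodic (ω₂ k₁ k₂ k₃ : ℝ) :
    resonanceFn ω₂ (k₁ + 2 * Real.pi) k₂ k₃ = resonanceFn ω₂ k₁ k₂ k₃ ∧
      resonanceFn ω₂ k₁ (k₂ + 2 * Real.pi) k₃ = resonanceFn ω₂ k₁ k₂ k₃ ∧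
      resonanceFn ω₂ k₁ k₂ (k₃ + 2 * Real.pi) = resonanceFn ω₂ k₁ k₂ k₃ := by
  have hp := dispersion_periodic ω₂
  unfold resonanceFn
  refine ⟨?_, ?_, ?_⟩
  · rw [hp, show k₁ + 2 * Real.pi + k₂ - k₃ = k₁ + k₂ - k₃ + 2 * Real.pi by ring, hp]
  · rw [hp, show k₁ + (k₂ + 2 * Real.pi) - k₃ = k₁ + k₂ - k₃ + 2 * Real.pi by ring, hp]
  · rw [hp, show k₁ + k₂ - (k₃ + 2 * Real.pi) = k₁ + k₂ - k₃ - 2 * Real.pi by ring, hp.sub_eq]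

/-- The vertex is `2π`-periodic in each momentum (two half-angle sines change sign). [folklore] -/
theorem contAsm_vertex_periodic (a b k₁ k₂ k₃ : ℝ) :
    vertex a b (k₁ + 2 * Real.pi) k₂ k₃ = vertex a b k₁ k₂ k₃ ∧
      vertex a b k₁ (k₂ + 2 * Real.pi) k₃ = vertex a b k₁ k₂ k₃ ∧
      vertex a b k₁ k₂ (k₃ + 2 * Real.pi) = vertex a b k₁ k₂ k₃ := by
  unfold vertex
  refine ⟨?_, ?_, ?_⟩
  · rw [show (k₁ + 2 * Real.pi) / 2 = k₁ / 2 + Real.pi by ring,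
      show (k₁ + 2 * Real.pi + k₂ - k₃) / 2 = (k₁ + k₂ - k₃) / 2 + Real.pi by ring,
      Real.sin_add_pi, Real.sin_add_pi]
    ring
  · rw [show (k₂ + 2 * Real.pi) / 2 = k₂ / 2 + Real.pi by ring,
      show (k₁ + (k₂ + 2 * Real.pi) - k₃) / 2 = (k₁ + k₂ - k₃) / 2 + Real.pi by ring,
      Real.sin_add_pi, Real.sin_add_pi]
    ring
  · rw [show (k₃ + 2 * Real.pi) / 2 = k₃ / 2 + Real.pi by ring,
      show (k₁ + k₂ - (k₃ + 2 * Real.pi)) / 2 = (k₁ + k₂ - k₃) / 2 - Real.pi by ring,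
      Real.sin_add_pi, Real.sin_sub_pi]
    ring

/-! ### Measure plumbing -/

/-- The cell measure `dk₁ (dk₃ dk₂)` on `(−π,π]³` as the restriction of Lebesgue measure on `ℝ³`.
[folklore] -/
theorem contAsm_cell_measure :
    (volume.restrict (Ioc (-Real.pi) Real.pi)).prod ((volume.restrict (Ioc (-Real.pi) Real.pi)).prod
      (volume.restrict (Ioc (-Real.pi) Real.pi))) =
      (volume : Measure (ℝ × ℝ × ℝ)).restrict
        (Ioc (-Real.pi) Real.pi ×ˢ (Ioc (-Real.pi) Real.pi ×ˢ Ioc (-Real.pi) Real.pi)) := by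
  rw [Measure.prod_restrict, Measure.prod_restrict, ← Measure.volume_eq_prod, ← Measure.volume_eq_prod]

/-- The pushforward of a weighted measure evaluated on a measurable set:
`(Ω_*(G μ))(A) = ∫ 1_A(Ω) G dμ`. [folklore] -/
theorem contAsm_map_withDensity_apply {α : Type*} [MeasurableSpace α] {μ : Measure α} {Ω : α → ℝ}
    (hΩ : Measurable Ω) (G : α → ℝ≥0∞) {A : Set ℝ} (hA : MeasurableSet A) :
    Measure.map Ω (μ.withDensity G) A = ∫⁻ p, A.indicator (fun _ => (1 : ℝ≥0∞)) (Ω p) * G p ∂μ := by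
  rw [Measure.map_apply hΩ hA, withDensity_apply _ (hΩ hA), ← lintegral_indicator (hΩ hA)]
  refine lintegral_congr fun p => ?_
  by_cases hp : Ω p ∈ A
  · rw [indicator_of_mem (show p ∈ Ω ⁻¹' A from hp), indicator_of_mem hp, one_mul]
  · rw [indicator_of_notMem (show p ∉ Ω ⁻¹' A from hp), indicator_of_notMem hp, zero_mul]

end Summit.AtomisticToContinuum.FouriersLaw.Theorems.MourreDissolution

end
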